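import Summits.ResolutionOfSingularities.ResolutionOfSingularities.Theorems.MarkedTransferCampaignW46FiniteExitBound
import HarnessLib

/-!
# [OURS · L1 W4.6 rung (i-a)′] The RUN LAYER of the finite-sequence exit bound: `FinLocalExitBound Rg` from a
# PER-POINT STEP MEASURE (cell res-hironaka, LADDER-RESOLUTION rung L, D-0089; campaign s46, seat res-D-pv-046 AS
# res-L1-s46-pv-9; host route MarkedTransfer, `--supports stmt-ResolutionOfSingularities-16156 --as helper`; companion of
# `MarkedTransferCampaignW46FiniteExitBound.lean` (res-L1-type-o1) and `…PlaneIsolated.lean` (res-L1-s46-pv-1))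

HONEST FRAMING. Nothing here is a statement of H. Hironaka's manuscript (2017-03-23, [Hironaka2017]) and nothing here
asserts that any statement of it holds. Everything is OURS (campaign definitions of cell res-hironaka) and PURE
BOOKKEEPING over the typed finite permissible sequences `CampaignW46.FinPermissibleRun` of the companion module; the only
geometric input is the companion's tree theorem `sing_subset_of_transform` («singular points only come from singular
points»). AI review is weaker than expert review. No `sorry`; axioms standard.

## What this file does (the «run layer» of the split agreed on HOME/STATUS 2026-08-27T04:27:43Z / 04:3xZ between
## res-L1-s46-pv-8 = res-D-pv-044 (invariant layer) and res-L1-s46-pv-9 = res-D-pv-046 (this file))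

The rung (i-a)′ target `FinLocalExitBound Rg` (a bound `β(A₀, E₀, x)` on the number of stages of ANY FINITE permissible
sequence inside `Rg` whose centre meets the fibre over the point `x` of stage `0`) is reduced to a ONE-STEP statement
about a per-point measure `μ(A, E, ξ) ∈ ℕ`:

* the hypothesis shape `hμ` («one-step fibre drop of `μ` inside `Rg`»; no `def` — naming is the OURS typer's) — **the
  invariant layer's deliverable**: for ONE permissible step `(A, E) ↦ (A′, E′)` inside
  `Rg` (binders = exactly the fields of a `FinPermissibleRun` step: `E` standard, `D` a §2.1-permissible centre, `π` the
  blow-up along the reduced ideal of `D` over the same base field, `E′ = E.transform π D`, both states in `Rg`), for every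
  `η ∈ Sing(E)` and every finite set `t` of points of `Sing(E′)` lying over `η`:
  `Σ_{ξ′ ∈ t} μ(A′, E′, ξ′) ≤ μ(A, E, η)`, and `<` if `η` lies on the centre `D`
  («fibre sums of `μ` over the singular locus do not go up, and drop strictly over the centre»).
* `finLocalExitBound_of_stepMeasureDrop` — **if every state of `Rg` has finite singular locus and `μ` satisfies the
  one-step fibre drop inside `Rg`, then `FinLocalExitBound Rg` holds with `β := μ`.** Proof (potential argument): along a finite
  run `r` put `Φ_m(x) := Σ_{η ∈ Sing(E_m), η ↦ x} μ(A_m, E_m, η)`; every point of `Sing(E_{m+1})` over `x` lies over a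
  point of `Sing(E_m)` over `x` (`sing_subset_of_transform`), so regrouping the sum along the fibres of `π_m`
  (`Finset.sum_fiberwise_of_maps_to`) and applying the one-step drop fibre by fibre gives
  `Φ_{m+1}(x) + [D_m meets the fibre over x] ≤ Φ_m(x)` (a centre meeting the fibre contains a point of `Sing(E_m)` over
  `x`, where the drop is strict); summing, `#s ≤ Φ_0(x) ≤ μ(A₀, E₀, x)`.
* `planeIsolatedFinLocalExitBound_of_stepMeasureDrop` — the specialisation to the regime of rung (i-a):
  **one-step fibre drop inside `regimePlaneIsolated` ⇒ `PlaneIsolatedFinLocalExitBound p K`**, for ANY `μ`; with the companion's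
  `planeIsolatedPermissiblyTerminates_of_finLocalExitBound` / `planeIsolatedTerminatesNabla_of_finLocalExitBound` the rung
  (résumé-free, literal and ∇-centred typed forms) then follows. What remains for rung (i-a) is therefore EXACTLY ONE
  measure `μ` with the one-step fibre drop inside `regimePlaneIsolated` — the (β1)–(β3) content recorded by res-L1-type-o1 /
  res-plan-2 (HOME/STATUS 2026-08-27T02:49:39Z / 03:13:15Z): a δ- / Hilbert–Samuel-type invariant of the germ of `(J, b)`
  at a closed point of a regular surface, its fibre sum over the exceptional curve after one point blow-up, and the window
  `b ≤ ord < 2b` forced by the regime. That is the invariant layer (res-L1-s46-pv-8), not this file.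

DESIGN POINTS. (T) The fibre condition is phrased with an arbitrary FINSET `t` of points of `Sing(E′)` over `η` rather
than «the» fibre, so that the definition needs no finiteness datum and no `Set.Finite.toFinset`; for a finite fibre it is
equivalent to the single inequality for the full fibre (sums of naturals are monotone in the finset). (C) The centre is
NOT assumed to be a point: if `D_m` meets the fibre over `x` in `y`, then `y ∈ Sing(E_m)` (§2.1) and the strict clause
at `η = y` pays for the stage; in `regimePlaneIsolated` every centre is a closed point anyway
(`IsPermissibleCentre.exists_eq_singleton_of_isolatedSing`). (J) `Φ_m` is given the junk value `0` beyond `len`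
(DESIGN POINT (PAD) of the companion: data beyond `len` are inert).

## References

* companion modules `MarkedTransferCampaignW46FiniteExitBound.lean` (p488284), `…PlaneIsolated.lean` (p477752/p483951),
  `…PermissibleReduction.lean` (p469934); HOME/STATUS 2026-08-27T01:06:33Z (res-plan-2 SLOT-PLANNER WORD (1)(b)),
  02:49:39Z (res-L1-type-o1 (β1)–(β3)), 04:27:43Z (res-L1-s46-pv-8 SPLIT PROPOSAL).
* O. Zariski, P. Samuel, *Commutative Algebra* II (1960), Appendix 5 (infinitely near points) — context only.
  [ZariskiSamuel1960]
-/

noncomputable section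

set_option linter.dupNamespace false -- mandated namespace of this single-conjunct summit

open CategoryTheory AlgebraicGeometry TopologicalSpace

namespace Summit.ResolutionOfSingularities.ResolutionOfSingularities.Theorems

namespace CampaignW46

open Literature.AlgebraicGeometry.Resolution
open Literature.AlgebraicGeometry.Hironaka2017.S02Preliminaries
open Scheme.IdealSheafData

universe u

variable {p : ℕ} [Fact p.Prime] {K : Type u} [Field K] [CharP K p]

/-! ## The one-step hypothesis on a per-point measure (the shape `hμ` below; NO new definition is introduced here —
the slot's OURS typer res-L1-type-o1 names it if the slot wants a decl)

«ONE-STEP FIBRE DROP of `μ` inside `Rg`»: for every permissible step inside `Rg` — ambient data `A`, `A′`, a standard ideal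
exponent `E` on `A.Z`, a §2.1-permissible centre `D`, the blow-up `π : A′.Z ⟶ A.Z` along the reduced ideal of `D` over the
same base field, `E′ = E.transform π D` (Def. 2.1) standard, with `Rg A E` and `Rg A′ E′` (binders = exactly the fields of a
`FinPermissibleRun` step) — for every `η ∈ Sing(E)` and every finite set `t` of points of `Sing(E′)` mapping to `η`: the sum
of `μ(A′, E′, ·)` over `t` is at most `μ(A, E, η)`, and strictly less if `η` lies on the centre `D`. -/

namespace FinPermissibleRun

variable (r : FinPermissibleRun p K)

/-- Below the length, a singular point of stage `m+1` lies over a singular point of stage `m`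
(`sing_subset_of_transform`). [folklore] -/
theorem π_mem_sing {m : ℕ} (hm : m < r.len) {y : (r.A (m + 1)).Z} (hy : y ∈ (r.E (m + 1)).sing) :
    r.π m y ∈ (r.E m).sing := by
  haveI : IsLocallyNoetherian (r.A (m + 1)).Z := ambient_isLocallyNoetherian _
  rw [r.E_succ m hm] at hy
  exact sing_subset_of_transform (r.blowup m hm) (r.E m) (r.permissible m hm).subset_sing hy

end FinPermissibleRun

/-! ## The run layer: a step measure gives the finite-sequence exit bound -/

/-- [OURS · L1 W4.6 rung (i-a)′] NOT a statement of the manuscript. **THE RUN LAYER.** In a regime all of whose states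
have finite singular locus, a per-point measure `μ` with the one-step fibre drop inside `Rg` (hypothesis `hμ`) yields
`FinLocalExitBound Rg` with `β := μ`: along any finite permissible sequence inside `Rg`, the number of stages whose centre
meets the fibre over a point `x` of stage `0` is at most `μ(A₀, E₀, x)`. Proof: the potential
`Φ_m(x) = Σ_{η ∈ Sing(E_m) over x} μ(A_m, E_m, η)` satisfies `Φ_{m+1}(x) + [D_m meets the fibre over x] ≤ Φ_m(x)`
(regroup along the fibres of `π_m`, which land in `Sing(E_m)` by `sing_subset_of_transform`, and apply the one-step drop
fibre by fibre; a centre meeting the fibre does so in a point of `Sing(E_m)`, where the drop is strict), and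
`Φ_0(x) ≤ μ(A₀, E₀, x)`. [folklore] -/
theorem finLocalExitBound_of_stepMeasureDrop {Rg : Regime p K}
    (hfin : ∀ (A : AmbientDatum p K) (E : IdealExponent A.Z), Rg A E → E.sing.Finite)
    (μ : ∀ A : AmbientDatum p K, IdealExponent A.Z → A.Z → ℕ)
    (hμ : ∀ (A A' : AmbientDatum p K) (E : IdealExponent A.Z) (E' : IdealExponent A'.Z) (D : Closeds A.Z)
      (π : A'.Z ⟶ A.Z), Rg A E → Rg A' E' → E.IsStandard → E'.IsStandard →
      E.IsPermissibleCentre A.hom D → A'.hom = π ≫ A.hom → IsBlowup π (vanishingIdeal D) →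
      E' = E.transform π D →
        ∀ η ∈ E.sing, ∀ t : Finset A'.Z, (∀ ξ' ∈ t, ξ' ∈ E'.sing ∧ π ξ' = η) →
          t.sum (μ A' E') ≤ μ A E η ∧ (η ∈ (D : Set A.Z) → t.sum (μ A' E') < μ A E η)) :
    FinLocalExitBound Rg := by
  classical
  refine ⟨μ, fun r hr x s hs => ?_⟩
  -- the singular points of stage `m ≤ len` over `x` form a finite set
  have hfin' : ∀ m, m ≤ r.len → ((r.E m).sing ∩ {η | r.down m η = x}).Finite :=
    fun m hm => (hfin _ _ (hr m hm)).subset Set.inter_subset_left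
  -- the potential (junk value `0` beyond the length)
  let Φ : ℕ → ℕ := fun m =>
    if hm : m ≤ r.len then ∑ η ∈ (hfin' m hm).toFinset, μ (r.A m) (r.E m) η else 0
  have Φ_eq : ∀ m (hm : m ≤ r.len), Φ m = ∑ η ∈ (hfin' m hm).toFinset, μ (r.A m) (r.E m) η :=
    fun m hm => dif_pos hm
  -- ONE STEP: `Φ (m+1) + [m ∈ s] ≤ Φ m` for `m < len`
  have step : ∀ m, m < r.len → Φ (m + 1) + (if m ∈ s then 1 else 0) ≤ Φ m := by
    intro m hm
    have hm₀ : m ≤ r.len := hm.le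
    have hm₁ : m + 1 ≤ r.len := hm
    rw [Φ_eq (m + 1) hm₁, Φ_eq m hm₀]
    set F' := (hfin' (m + 1) hm₁).toFinset with hF'
    set F := (hfin' m hm₀).toFinset with hF
    have memF' : ∀ ξ', ξ' ∈ F' ↔ ξ' ∈ (r.E (m + 1)).sing ∧ r.down (m + 1) ξ' = x := fun ξ' => by
      rw [hF', Set.Finite.mem_toFinset]; rfl
    have memF : ∀ η, η ∈ F ↔ η ∈ (r.E m).sing ∧ r.down m η = x := fun η => by
      rw [hF, Set.Finite.mem_toFinset]; rfl
    -- `π_m` maps `F'` into `F`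
    have hmaps : ∀ ξ' ∈ F', r.π m ξ' ∈ F := by
      intro ξ' hξ'
      obtain ⟨hsing, hdown⟩ := (memF' ξ').1 hξ'
      refine (memF _).2 ⟨r.π_mem_sing hm hsing, ?_⟩
      -- `down (m+1) = π m ≫ down m`
      rw [← Scheme.Hom.comp_apply]
      exact hdown
    -- regroup the sum over `F'` along the fibres of `π_m`
    rw [← Finset.sum_fiberwise_of_maps_to hmaps]
    -- the one-step drop, fibre by fibre
    have hfib : ∀ η ∈ F,
        (∑ ξ' ∈ F' with r.π m ξ' = η, μ (r.A (m + 1)) (r.E (m + 1)) ξ') ≤ μ (r.A m) (r.E m) η ∧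
          (η ∈ (r.D m : Set (r.A m).Z) →
            (∑ ξ' ∈ F' with r.π m ξ' = η, μ (r.A (m + 1)) (r.E (m + 1)) ξ') < μ (r.A m) (r.E m) η) := by
      intro η hη
      refine hμ (r.A m) (r.A (m + 1)) (r.E m) (r.E (m + 1)) (r.D m) (r.π m) (hr m hm₀) (hr (m + 1) hm₁)
        (r.standard m hm₀) (r.standard (m + 1) hm₁) (r.permissible m hm) (r.hom_eq m hm) (r.blowup m hm)
        (r.E_succ m hm) η ((memF η).1 hη).1 _ fun ξ' hξ' => ?_
      rw [Finset.mem_filter] at hξ'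
      exact ⟨((memF' ξ').1 hξ'.1).1, hξ'.2⟩
    by_cases hms : m ∈ s
    · -- the centre meets the fibre over `x` in a point `y ∈ Sing(E_m)` over `x`: strict drop there
      rw [if_pos hms]
      obtain ⟨-, y, hyD, hyx⟩ := hs m hms
      have hyF : y ∈ F := (memF y).2 ⟨(r.permissible m hm).subset_sing hyD, hyx⟩
      exact Nat.add_one_le_iff.2 (Finset.sum_lt_sum (fun η hη => (hfib η hη).1) ⟨y, hyF, (hfib y hyF).2 hyD⟩)
    · rw [if_neg hms, add_zero]
      exact Finset.sum_le_sum fun η hη => (hfib η hη).1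
  -- SUMMATION: `#(s ∩ [0, m)) + Φ m ≤ Φ 0` for `m ≤ len`
  have main : ∀ m, m ≤ r.len → (s.filter (· < m)).card + Φ m ≤ Φ 0 := by
    intro m
    induction m with
    | zero =>
      intro _
      have h0 : s.filter (· < 0) = ∅ := Finset.filter_false_of_mem fun k _ => Nat.not_lt_zero k
      rw [h0, Finset.card_empty, zero_add]
    | succ m ih =>
      intro hm₁
      have hm : m < r.len := hm₁
      have hcard : (s.filter (· < m + 1)).card = (s.filter (· < m)).card + (if m ∈ s then 1 else 0) := by
        by_cases hms : m ∈ s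
        · rw [if_pos hms]
          have : s.filter (· < m + 1) = insert m (s.filter (· < m)) := by
            ext k
            simp only [Finset.mem_filter, Finset.mem_insert]
            constructor
            · rintro ⟨hk, hlt⟩
              by_cases hkm : k = m
              · exact Or.inl hkm
              · exact Or.inr ⟨hk, by omega⟩
            · rintro (rfl | ⟨hk, hlt⟩)
              · exact ⟨hms, Nat.lt_succ_self _⟩
              · exact ⟨hk, Nat.lt_succ_of_lt hlt⟩
          rw [this, Finset.card_insert_of_notMem]
          intro h
          exact lt_irrefl m (Finset.mem_filter.1 h).2
        · rw [if_neg hms, add_zero]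
          congr 1
          ext k
          simp only [Finset.mem_filter]
          constructor
          · rintro ⟨hk, hlt⟩
            have hkm : k ≠ m := fun h => hms (h ▸ hk)
            exact ⟨hk, by omega⟩
          · rintro ⟨hk, hlt⟩
            exact ⟨hk, Nat.lt_succ_of_lt hlt⟩
      calc (s.filter (· < m + 1)).card + Φ (m + 1)
          = (s.filter (· < m)).card + (Φ (m + 1) + (if m ∈ s then 1 else 0)) := by rw [hcard]; ring
        _ ≤ (s.filter (· < m)).card + Φ m := Nat.add_le_add_left (step m hm) _
        _ ≤ Φ 0 := ih hm.le
  -- CONCLUSION: every index of `s` is `< len`, and `Φ 0 ≤ μ(A₀, E₀, x)`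
  have hsall : s.filter (· < r.len) = s := Finset.filter_true_of_mem fun m hm => (hs m hm).1
  have hΦ0 : Φ 0 ≤ μ (r.A 0) (r.E 0) x := by
    rw [Φ_eq 0 (Nat.zero_le _)]
    have hsub : (hfin' 0 (Nat.zero_le _)).toFinset ⊆ {x} := by
      intro η hη
      rw [Set.Finite.mem_toFinset] at hη
      exact Finset.mem_singleton.2 hη.2
    calc ∑ η ∈ (hfin' 0 (Nat.zero_le _)).toFinset, μ (r.A 0) (r.E 0) η
        ≤ ∑ η ∈ ({x} : Finset (r.A 0).Z), μ (r.A 0) (r.E 0) η := Finset.sum_le_sum_of_subset hsub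
      _ = μ (r.A 0) (r.E 0) x := Finset.sum_singleton _ _
  calc s.card = (s.filter (· < r.len)).card := by rw [hsall]
    _ ≤ (s.filter (· < r.len)).card + Φ r.len := Nat.le_add_right _ _
    _ ≤ Φ 0 := main r.len le_rfl
    _ ≤ μ (r.A 0) (r.E 0) x := hΦ0

/-- [OURS · L1 W4.6 rung (i-a)′] NOT a statement of the manuscript. **Rung (i-a)′ from a step measure**: any per-point
measure `μ` with the one-step fibre drop inside `regimePlaneIsolated` (surfaces with finite singular locus of closed
points, at every stage) proves `PlaneIsolatedFinLocalExitBound p K` (with `β := μ`). [folklore] -/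
theorem planeIsolatedFinLocalExitBound_of_stepMeasureDrop
    (μ : ∀ A : AmbientDatum p K, IdealExponent A.Z → A.Z → ℕ)
    (hμ : ∀ (A A' : AmbientDatum p K) (E : IdealExponent A.Z) (E' : IdealExponent A'.Z) (D : Closeds A.Z)
      (π : A'.Z ⟶ A.Z), regimePlaneIsolated (p := p) (K := K) A E → regimePlaneIsolated (p := p) (K := K) A' E' → E.IsStandard → E'.IsStandard →
      E.IsPermissibleCentre A.hom D → A'.hom = π ≫ A.hom → IsBlowup π (vanishingIdeal D) →
      E' = E.transform π D →
        ∀ η ∈ E.sing, ∀ t : Finset A'.Z, (∀ ξ' ∈ t, ξ' ∈ E'.sing ∧ π ξ' = η) →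
          t.sum (μ A' E') ≤ μ A E η ∧ (η ∈ (D : Set A.Z) → t.sum (μ A' E') < μ A E η)) :
    PlaneIsolatedFinLocalExitBound p K :=
  finLocalExitBound_of_stepMeasureDrop (fun _ _ hRg => hRg.2.1) μ hμ

/-- **The rung, all forms, from a step measure** (assembly with the companions): résumé-free termination on surfaces with
isolated singular locus, and the typed rungs for every notion instance, literal and ∇-centred. [folklore] -/
theorem planeIsolatedTerminates_of_stepMeasureDrop
    (μ : ∀ A : AmbientDatum p K, IdealExponent A.Z → A.Z → ℕ)
    (hμ : ∀ (A A' : AmbientDatum p K) (E : IdealExponent A.Z) (E' : IdealExponent A'.Z) (D : Closeds A.Z)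
      (π : A'.Z ⟶ A.Z), regimePlaneIsolated (p := p) (K := K) A E → regimePlaneIsolated (p := p) (K := K) A' E' → E.IsStandard → E'.IsStandard →
      E.IsPermissibleCentre A.hom D → A'.hom = π ≫ A.hom → IsBlowup π (vanishingIdeal D) →
      E' = E.transform π D →
        ∀ η ∈ E.sing, ∀ t : Finset A'.Z, (∀ ξ' ∈ t, ξ' ∈ E'.sing ∧ π ξ' = η) →
          t.sum (μ A' E') ≤ μ A E η ∧ (η ∈ (D : Set A.Z) → t.sum (μ A' E') < μ A E η)) :
    PlaneIsolatedPermissiblyTerminates p K ∧ PlaneIsolatedTerminates p K ∧ PlaneIsolatedTerminatesNabla p K :=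
  have h := planeIsolatedFinLocalExitBound_of_stepMeasureDrop μ hμ
  ⟨planeIsolatedPermissiblyTerminates_of_finLocalExitBound h, planeIsolatedTerminatesNabla_of_finLocalExitBound h⟩

end CampaignW46

end Summit.ResolutionOfSingularities.ResolutionOfSingularities.Theorems

end
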